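import Summits.ABC.IUTFork.Conditional.AbcOfSGenuineKChosenDepthRadTriple
import Summits.ABC.IUTFork.Conditional.AbcOfSGenuineKChosenDepthRadCover
import HarnessLib

/-!
# Branch C / R-W lane P−·block K: the EXACT-RADIUS («RAD») refutation at abc-triple data, MULTI-DATUM TABLE form —
# a certified numerics table `(a, b, c, l, p, v, i₀, D, certs)` becomes kernel rows by ONE theorem application per row

PROOF-ONLY file (no `def`, no new `Prop`, no instance) of the abc-iut cell (D-0079 R-W numerics crew seat abc-iut-W-num-4 = ANNEX-1 owner /
table generator, gen 3). TAKES NO SIDE on [IUTchIII] Cor. 3.12 or on any author. NO new engine: abc-iut-w5-d236's certificate-list refutation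
`GenuineK.not_pilotKummerCompatHull_chosen_triple_of_radCerts` (p467119; the exact-radius test of `AbcOfSGenuineKChosenDepthRadRatPoint` p464754
read at ONE diagonal summand, local type from the Tate-exact lemmas `GenuineK.absRamificationIdx_kOf_dvd_of_triple_{thirty,ten,six,two}`) and the
coverage lemma `RadRow.cover_of_prime` (p469301) are packaged so that a whole TABLE of rows — each row a literal
`(a, b, c, l, p, v, i₀, D, certs)` = (abc triple, prime `l`, pole prime `p ∉ {2, 3, 5, l}` with `p^v ∥ abc`, label `j = i₀ + 1 ≤ l⋆`, local-type
class `e ∣ D·l` with `D = 30`, or `10` (`3 ∣ v`), or `6` (`5 ∣ v`), or `2` (`15 ∣ v`), and integer certificates `(e, A, a₀, N)` for every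
`e ∈ {d, d·l : d ∣ D}`) — is discharged by ONE Boolean validity hypothesis on literals (`tab.all (… decide …) = true`, closed in a rows file by `decide +kernel`:
the kernel itself re-checks every integer fact of every row), and every (datum, l) keyed `(a, c, l)` in the table gets:
at EVERY genuine Θ-volume datum `T` over `(ratPoint (a/c), l)` the hull-level clause S_H (CHOSEN realising ideles, PINNED reading — verbatim the
per-datum object of the window binders `hSHw`/`hSHwBad` p447945/p450130/p453137) FAILS for every choice of the free context binders and Kummer datum.

* §1 `GenuineK.not_pilotKummerCompatHull_chosen_triple_of_radTable` — the table master (pure bookkeeping: `List.mem_map`, the row's validity,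
  a case split on the local-type class `D`, one application of p467119 with p469301's cover).

Intended rows: the R-W numerics table's rational data OUTSIDE the 57 known high-quality triples (README «block K»; this seat's ANNEX-1 =
exhaustive Szpiro-bad scan `c ≤ 10⁷`, `l < 400`), filed separately as `…RadTableAnnex1Rows*` with the table literal as the certificate.

HONEST SCOPE as in the parents: an UPPER BOUND on the hull read at ONE diagonal summand; SHARP reading; per-label licence STRONGER than print;
admissibility / Szpiro-badness / (P6) of `(ratPoint (a/c), l)` and non-emptiness of the datum type are NOT claimed (apex inputs); «refuted as
typed» ≠ «refuted in print»; nothing about the number-level Corollary; typed ≠ proved; instantiated ≠ endorsed.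
[cite: Mochizuki2012, IUTchIII Cor. 3.12 Step (xi-f) p. 184; IUTchIV Prop. 1.2 (i)(ii) p. 10, Cor. 2.2 (ii) proof p. 44–46, Thm. 1.10 Steps (ii)–(iii) p. 24–26]
[cite: Serre1972, §1.11–§1.12] [cite: NeukirchANT1999, Ch. II (5.5)] [cite: Oesterle1988, §1] [claim: Mochizuki2012, status: disputed] for every IUT sentence quoted.
-/

noncomputable section

open Set Function NumberField IsDedekindDomain

namespace Summit.ABC.IUTFork.Conditional

open Thm311 Thm311.Real Cor312 Cor312Vol Cor312Prov Literature.IUT.LogThetaLattice Literature.IUT.LogVolume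
  Literature.IUT.HodgeTheaters Literature.IUT.LogVolume.ThetaData Literature.IUT.LogVolume.Cor22
open Literature.NumberTheory.NumberFields Literature.NumberTheory.GaloisRepresentations.Ultrametric
open Literature.NumberTheory.DiophantineGeometry Literature.NumberTheory.DiophantineGeometry.GenEll Summit.ABC.ABC.Theorems

/-! ## §1. The table master -/

/-- **RAD REFUTATION, MULTI-DATUM TABLE FORM.** `tab` is a list of rows `(a, b, c, l, p, v, i₀, D, certs)`; the validity hypothesis is the Boolean
`tab.all (fun r => decide (…)) = true` of the row predicate: `a + b = c` positive with `gcd(a, b) = 1`; `l` prime; `p` prime, `p ∉ {2, 3, 5, l}`; `1 ≤ v`, `p^v ∣ abc`, `p^{v+1} ∤ abc`;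
`i₀ + 1 ≤ (l−1)/2`; the local-type class `D = 30 ∨ (D = 10 ∧ 3 ∣ v) ∨ (D = 6 ∧ 5 ∣ v) ∨ (D = 2 ∧ 15 ∣ v)` with `p ∤ D·l`; certificates with first
entry `d` and `d·l` for every `d ∣ D`; and for every certificate `(e, A, a₀, N)` the window `(A−1)(p−2) < e ≤ A(p−2)`, the turning point
`a₀ = 0 ∨ p^{a₀−1}(p−1) < e`, `e ≤ p^{a₀}(p−1)`, and the two RAD inequalities of p464754 with `h = 2v`, `δ = e − 1`. THEN for every `(a, c, l)`
keyed in the table and EVERY genuine Θ-volume datum `T` over `(ratPoint (a/c), l)`, the hull-level clause S_H at the genuine sharp setting over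
`T.K` (CHOSEN realising ideles, PINNED reading) FAILS for every choice of the free context binders and Kummer datum — one application of
abc-iut-w5-d236's `…_triple_of_radCerts` (p467119) at the row, local type `e ∣ D·l` by `…_of_triple_{thirty,ten,six,two}`, coverage of
`Nat.divisors (D·l)` by `RadRow.cover_of_prime` (p469301). [cite: Mochizuki2012, IUTchIII Cor. 3.12 Step (xi-f) p. 184; IUTchIV Prop. 1.2 (i)(ii) p. 10]
[cite: NeukirchANT1999, Ch. II (5.5)] [claim: Mochizuki2012, status: disputed] -/
theorem GenuineK.not_pilotKummerCompatHull_chosen_triple_of_radTable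
    (tab : List (ℕ × ℕ × ℕ × ℕ × ℕ × ℕ × ℕ × ℕ × List (ℕ × ℕ × ℕ × ℤ)))
    (htab : (tab.all fun r => match r with
      | (a, b, c, l, p, v, i₀, D, certs) => decide (
        (0 < a ∧ 0 < b ∧ a + b = c ∧ Nat.gcd a b = 1) ∧ Nat.Prime l ∧ Nat.Prime p ∧ p ≠ 2 ∧ p ≠ 3 ∧ p ≠ 5 ∧ p ≠ l ∧
        1 ≤ v ∧ p ^ v ∣ a * b * c ∧ ¬ p ^ (v + 1) ∣ a * b * c ∧ i₀ + 1 ≤ (l - 1) / 2 ∧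
        (D = 30 ∨ (D = 10 ∧ 3 ∣ v) ∨ (D = 6 ∧ 5 ∣ v) ∨ (D = 2 ∧ 15 ∣ v)) ∧ ¬ p ∣ D * l ∧
        (∀ d ∈ Nat.divisors D, ∃ t ∈ certs, t.1 = d) ∧ (∀ d ∈ Nat.divisors D, ∃ t ∈ certs, t.1 = d * l) ∧
        (∀ t ∈ certs, 1 ≤ t.1 ∧ (t.2.1 - 1) * (p - 2) < t.1 ∧ t.1 ≤ t.2.1 * (p - 2) ∧
          (t.2.2.1 = 0 ∨ (p : ℤ) ^ (t.2.2.1 - 1) * ((p : ℤ) - 1) < t.1) ∧ (t.1 : ℤ) ≤ (p : ℤ) ^ t.2.2.1 * ((p : ℤ) - 1) ∧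
          2 * (l : ℤ) * t.1 * t.2.2.2 ≤
            ((i₀ : ℤ) + 1) ^ 2 * ((2 * v : ℕ) : ℤ) * t.1 - 2 * l * (((i₀ : ℤ) + 1) * ((t.1 : ℤ) - 1) + ((i₀ : ℤ) + 2) * t.2.1) ∧
          ((2 * v : ℕ) : ℤ) * t.1 < 2 * l * ((t.1 : ℤ) * t.2.2.2 + ((i₀ : ℤ) + 2) * ((p : ℤ) ^ t.2.2.1 - t.1 * t.2.2.1))))) = true)
    {a c l : ℕ} (T : Cor22.ThetaVolumeDatumAt (ratPoint ((a : ℚ) / c)) l)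
    (hmem : (a, c, l) ∈ tab.map fun r => (r.1, r.2.2.1, r.2.2.2.1)) :
    letI := T.instFieldF; letI := T.instNumberFieldF; letI := T.instAlgebraF; letI := T.instFieldK
    letI := T.instNumberFieldK; letI := T.instAlgebraK; letI := T.instFieldFbar; letI := T.instAlgebraFbar
    letI := T.instAlgebraKFbar; letI := T.instIsElliptic
    ∀ (M : Type) [Field M] [NumberField M]
      (archPk : ∀ (j : (thetaIndex (pilotDataOfK T.D T.K)).Label) (vQ : (thetaIndex (pilotDataOfK T.D T.K)).VQ),
        Set ((logShellsDH (pilotDataOfK T.D T.K) (analyticLogv T.K)).Packet j vQ))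
      (archSub : ∀ (j : (thetaIndex (pilotDataOfK T.D T.K)).Label) (v : (thetaIndex (pilotDataOfK T.D T.K)).V),
        Set ((logShellsDH (pilotDataOfK T.D T.K) (analyticLogv T.K)).Packet j ((thetaIndex (pilotDataOfK T.D T.K)).over v)))
      (Ψ : ℤ → ∀ v : (thetaIndex (pilotDataOfK T.D T.K)).V, v ∈ (thetaIndex (pilotDataOfK T.D T.K)).Vbad →
        Set ((logShellsDH (pilotDataOfK T.D T.K) (analyticLogv T.K)).StarPacket v))
      (act : ℤ → ∀ v : (thetaIndex (pilotDataOfK T.D T.K)).V, v ∈ (thetaIndex (pilotDataOfK T.D T.K)).Vbad →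
        (logShellsDH (pilotDataOfK T.D T.K) (analyticLogv T.K)).StarPacket v →
          Module.End ℚ ((logShellsDH (pilotDataOfK T.D T.K) (analyticLogv T.K)).StarPacket v))
      (Mmod : ℤ → ∀ j : (thetaIndex (pilotDataOfK T.D T.K)).LabelStar, Set ((logShellsDH (pilotDataOfK T.D T.K) (analyticLogv T.K)).GlobalPacket j.1))
      (region : ℤ → ∀ j : (thetaIndex (pilotDataOfK T.D T.K)).LabelStar, FinDivisor M → ∀ vQ : (thetaIndex (pilotDataOfK T.D T.K)).VQ,
        Set ((logShellsDH (pilotDataOfK T.D T.K) (analyticLogv T.K)).Packet j.1 vQ))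
      (frobAdm : ℤ → ℤ → ∀ (j : (thetaIndex (pilotDataOfK T.D T.K)).Label) (vQ : (thetaIndex (pilotDataOfK T.D T.K)).VQ),
        Set ((logShellsDH (pilotDataOfK T.D T.K) (analyticLogv T.K)).Packet j vQ) → Prop)
      (frobLogvol : ℤ → ℤ → ∀ (j : (thetaIndex (pilotDataOfK T.D T.K)).Label) (vQ : (thetaIndex (pilotDataOfK T.D T.K)).VQ),
        Set ((logShellsDH (pilotDataOfK T.D T.K) (analyticLogv T.K)).Packet j vQ) → ℝ)
      (frobΨ : ℤ → ℤ → ∀ v : (thetaIndex (pilotDataOfK T.D T.K)).V, v ∈ (thetaIndex (pilotDataOfK T.D T.K)).Vbad →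
        Set ((logShellsDH (pilotDataOfK T.D T.K) (analyticLogv T.K)).StarPacket v))
      (frobMmod : ℤ → ℤ → ∀ j : (thetaIndex (pilotDataOfK T.D T.K)).LabelStar, Set ((logShellsDH (pilotDataOfK T.D T.K) (analyticLogv T.K)).GlobalPacket j.1))
      (unitImage : ℤ → ℤ → ℕ → ∀ (j : (thetaIndex (pilotDataOfK T.D T.K)).Label) (vQ : (thetaIndex (pilotDataOfK T.D T.K)).VQ),
        Set ((logShellsDH (pilotDataOfK T.D T.K) (analyticLogv T.K)).Packet j vQ))
      (ballImage : ℤ → ℤ → ∀ (j : (thetaIndex (pilotDataOfK T.D T.K)).Label) (vQ : (thetaIndex (pilotDataOfK T.D T.K)).VQ),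
        Set ((logShellsDH (pilotDataOfK T.D T.K) (analyticLogv T.K)).Packet j vQ))
      (thetaDiv : ℤ → ℤ → LgpDivisor M (thetaIndex (pilotDataOfK T.D T.K)).lstar)
      (n : ℤ) {HT : Type} {LogLink : HT → HT → Type} {IsFull : ∀ {s t : HT}, LogLink s t → Prop}
      (lat : LGPGaussianLogThetaLattice LogLink IsFull)
      {Frd : Type} {IsoF : Frd → Frd → Type} {Ob : Frd → Type} {realify : Frd → Frd} {Strip : Type}
      {IsoS : Strip → Strip → Type} {Mv : ∀ v : (thetaIndex (pilotDataOfK T.D T.K)).V, v ∈ (thetaIndex (pilotDataOfK T.D T.K)).Vbad → Type}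
      [∀ v h, Monoid (Mv v h)]
      (sig : GlobalLGPFrobenioidSignature (thetaIndex (pilotDataOfK T.D T.K)).lstar (thetaIndex (pilotDataOfK T.D T.K)).V
        (· ∈ (thetaIndex (pilotDataOfK T.D T.K)).Vbad) Frd IsoF Ob realify Strip IsoS Mv)
      (split : SplittingMonoids Mv) {ObΔ : Type} {N : ∀ v : (thetaIndex (pilotDataOfK T.D T.K)).V, v ∈ (thetaIndex (pilotDataOfK T.D T.K)).Vbad → Type}
      [∀ v h, Monoid (N v h)] (qData : QPilotData ObΔ N)
      (qK : ∀ v : (thetaIndex (pilotDataOfK T.D T.K)).V, v ∈ (thetaIndex (pilotDataOfK T.D T.K)).Vbad →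
        Set ((logShellsDH (pilotDataOfK T.D T.K) (analyticLogv T.K)).StarPacket v)),
      ¬ Cor312Vol.PilotKummerCompatHull
          (LatticeSituation.ofShells (logShellsDH (pilotDataOfK T.D T.K) (analyticLogv T.K)) M archPk archSub
            (summandPiecesPr (pilotDataOfK T.D T.K) (logvAnalytic_analyticLogv (F := T.K))).Adm
            (summandPiecesPr (pilotDataOfK T.D T.K) (logvAnalytic_analyticLogv (F := T.K))).logvol Ψ act Mmod region frobAdm frobLogvol frobΨ
            frobMmod unitImage ballImage thetaDiv)
          (settingPrVolSharp (pilotDataOfK T.D T.K) (logvAnalytic_analyticLogv (F := T.K)) M archPk archSub Ψ act Mmod region n lat sig split qData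
            (exists_realising_qIdeles_pilotDataOfK T.D).choose (exists_realising_thetaIdeles_pilotDataOfK T.D).choose
            (exists_realising_qIdeles_pilotDataOfK T.D).choose_spec.1 (exists_realising_qIdeles_pilotDataOfK T.D).choose_spec.2.1)
          (fun _ => Cor312.Setting.qRegion
            (settingPrVolSharp (pilotDataOfK T.D T.K) (logvAnalytic_analyticLogv (F := T.K)) M archPk archSub Ψ act Mmod region n lat sig split qData
              (exists_realising_qIdeles_pilotDataOfK T.D).choose (exists_realising_thetaIdeles_pilotDataOfK T.D).choose
              (exists_realising_qIdeles_pilotDataOfK T.D).choose_spec.1 (exists_realising_qIdeles_pilotDataOfK T.D).choose_spec.2.1)) qK := by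
  obtain ⟨r, hr, hkey⟩ := List.mem_map.1 hmem
  have hrow := List.all_eq_true.1 htab r hr
  obtain ⟨a', b, c', l', p, v, i₀, D, certs⟩ := r
  simp only [Prod.mk.injEq] at hkey
  obtain ⟨rfl, rfl, rfl⟩ := hkey
  dsimp only at hrow
  obtain ⟨⟨ha, hb, hsum, hgcd⟩, hlp, hp, hp2, hp3, hp5, hpl, hv, hdvd, hndvd, hil, hD, hpD, hcov1, hcov2, hvalid⟩ :=
    of_decide_eq_true hrow
  have habc' : IsABCTriple a' b c' := ⟨ha, hb, hsum, hgcd⟩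
  -- case split on the local-type class `D`; in each case ONE application of p467119 with the matching Tate-exact lemma and p469301's cover
  rcases hD with hD | ⟨hD, h3⟩ | ⟨hD, h5⟩ | ⟨hD, h15⟩ <;> subst hD
  · exact GenuineK.not_pilotKummerCompatHull_chosen_triple_of_radCerts habc' T ⟨p, hp⟩ hp2 hpl v hv hdvd hndvd i₀ hil (30 * l') hpD
      (GenuineK.absRamificationIdx_kOf_dvd_of_triple_thirty habc' T ⟨p, hp⟩ hp2 hp3 hp5 hpl hv hdvd hndvd) certs
      (RadRow.cover_of_prime hlp (by norm_num) certs hcov1 hcov2) hvalid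
  · exact GenuineK.not_pilotKummerCompatHull_chosen_triple_of_radCerts habc' T ⟨p, hp⟩ hp2 hpl v hv hdvd hndvd i₀ hil (10 * l') hpD
      (GenuineK.absRamificationIdx_kOf_dvd_of_triple_ten habc' T ⟨p, hp⟩ hp2 hp3 hp5 hpl hv hdvd hndvd h3) certs
      (RadRow.cover_of_prime hlp (by norm_num) certs hcov1 hcov2) hvalid
  · exact GenuineK.not_pilotKummerCompatHull_chosen_triple_of_radCerts habc' T ⟨p, hp⟩ hp2 hpl v hv hdvd hndvd i₀ hil (6 * l') hpD
      (GenuineK.absRamificationIdx_kOf_dvd_of_triple_six habc' T ⟨p, hp⟩ hp2 hp3 hp5 hpl hv hdvd hndvd h5) certs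
      (RadRow.cover_of_prime hlp (by norm_num) certs hcov1 hcov2) hvalid
  · exact GenuineK.not_pilotKummerCompatHull_chosen_triple_of_radCerts habc' T ⟨p, hp⟩ hp2 hpl v hv hdvd hndvd i₀ hil (2 * l') hpD
      (GenuineK.absRamificationIdx_kOf_dvd_of_triple_two habc' T ⟨p, hp⟩ hp2 hp3 hp5 hpl hv hdvd hndvd h15) certs
      (RadRow.cover_of_prime hlp (by norm_num) certs hcov1 hcov2) hvalid

end Summit.ABC.IUTFork.Conditional

end
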